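import Mathlib.Combinatorics.SimpleGraph.Metric
import Mathlib.Combinatorics.SimpleGraph.Acyclic
import Literature.AnabelianGeometry.SemiGraphs.FreeGroupsAndActionsProofs2
import Literature.AnabelianGeometry.SemiGraphs.SubdivisionLemmas
import Literature.AnabelianGeometry.SemiGraphs.SemiGraphIsoTransport
import Literature.AnabelianGeometry.SemiGraphs.TreeGeodesics
import HarnessLib

/-!
# Disjoint fixed loci of two tree automorphisms are separated by an edge ([SemiAnbd] Lemma 1.8 (ii), p. 20)

Mochizuki, *Semi-graphs of anabelioids*, Publ. RIMS **42** (2006) 221–322, §1, Lemma 1.8 (ii) p. 20 (finite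
group actions on trees: fixed vertices, "`Γ` acts trivially on any geodesic that joins them" — "implicit in the
theory of [Serre]") [cite: MochizukiSemiAnbd2006, Lem. 1.8(ii)(b) p.20].

PROOF-ONLY tool file (abc-iut cell, layer L3, row «C₀-ISOLATED@RAYLESS-STAR», seat abc-iut-L3-t8 gen 8; no
definition, nothing specific to anabelioids).  The elementary tree geometry behind the two-level "bridge"
argument of `MetabelianLeafStarEscapeIsolated.lean`:

* `SimpleGraph.IsTree.exists_adj_forall_walk_mem_edges` — in a tree, two DISJOINT non-empty CONVEX sets of
  nodes `A`, `B` (convex: closed under the nodes of paths between members) are separated by one edge `u ~ v`,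
  `u ∈ A`, `v ∉ A`, lying on EVERY walk from `A` to `B` (a closest pair `a₀ ∈ A`, `b₀ ∈ B` and the first edge of
  the geodesic `[a₀, b₀]`; every edge of a tree is a bridge);
* `SemiGraph.exists_edge_forall_walk_mem_support` — for two automorphisms `φ`, `ψ` of a semi-graph TREE without
  inversions (an automorphism fixing an edge fixes its branches) all of whose branches abut, each with a fixed
  vertex but with NO COMMON fixed vertex: there is an EDGE `e₀` of `T` whose point lies on every walk of the
  barycentric subdivision from a `φ`-fixed vertex to a `ψ`-fixed vertex (the fixed loci are convex by
  abc-iut-L3-t11's `nodeMap_eq_self_of_isPath`, disjoint as node sets, and the separating edge of the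
  subdivision is `z – β` or `e – β`, whence the edge-point `edgeOf β`, resp. `e`);
* `SemiGraph.exists_walk_nodeMap` — a morphism maps walks of the subdivision to walks (branches of an edge map
  ONTO the branches of the image edge: abc-iut-L3-t1's `Hom.exists_branchMap_eq`, `Pullback.lean`).

Nothing here bears on [IUTchIII] Cor. 3.12; no side taken.
-/

namespace Literature.AnabelianGeometry.SemiGraphs

open SimpleGraph

universe u

/-! ### A bridge between two disjoint convex sets of a tree -/

/-- **Two disjoint non-empty convex node sets of a tree are separated by an edge lying on every walk between
them.**  (Closest pair `a₀ ∈ A`, `b₀ ∈ B`; the first edge `a₀ ~ v` of the geodesic `[a₀, b₀]` has `v ∉ A` by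
minimality, and a walk from `A` to `B` avoiding it would close — through `A`, through `B` and back along the
rest of the geodesic — a circuit through that edge, which is a bridge.) [cite: MochizukiSemiAnbd2006, Lem. 1.8(ii)(b) p.20] -/
theorem _root_.SimpleGraph.IsTree.exists_adj_forall_walk_mem_edges {V : Type*} {S : SimpleGraph V}
    (hS : S.IsTree) {A B : Set V}
    (hA : ∀ x ∈ A, ∀ y ∈ A, ∀ q : S.Walk x y, q.IsPath → ∀ z ∈ q.support, z ∈ A)
    (hB : ∀ x ∈ B, ∀ y ∈ B, ∀ q : S.Walk x y, q.IsPath → ∀ z ∈ q.support, z ∈ B)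
    (hAB : Disjoint A B) (hAne : A.Nonempty) (hBne : B.Nonempty) :
    ∃ u v : V, u ∈ A ∧ v ∉ A ∧ S.Adj u v ∧ ∀ a ∈ A, ∀ b ∈ B, ∀ w : S.Walk a b, s(u, v) ∈ w.edges := by
  classical
  -- a closest pair `a₀ ∈ A`, `b₀ ∈ B`
  have hex : ∃ n : ℕ, ∃ a ∈ A, ∃ b ∈ B, S.dist a b = n := by
    obtain ⟨a, ha⟩ := hAne
    obtain ⟨b, hb⟩ := hBne
    exact ⟨_, a, ha, b, hb, rfl⟩
  obtain ⟨a₀, ha₀, b₀, hb₀, hd⟩ := Nat.find_spec hex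
  have hmin : ∀ a ∈ A, ∀ b ∈ B, S.dist a₀ b₀ ≤ S.dist a b := fun a ha b hb => by
    rw [hd]
    exact Nat.find_min' hex ⟨a, ha, b, hb, rfl⟩
  -- every edge of the tree is a bridge
  have hbridge : ∀ {x y : V}, S.Adj x y → ∀ p : S.Walk x y, s(x, y) ∈ p.edges := fun hxy =>
    SimpleGraph.isBridge_iff_forall_walk_mem_edges.mp
      (SimpleGraph.isAcyclic_iff_forall_isBridge.mp hS.isAcyclic hxy)
  -- the geodesic `[a₀, b₀]` and its first edge `a₀ ~ v`
  obtain ⟨γ, hγp, hγl⟩ := (hS.connected a₀ b₀).exists_path_of_dist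
  cases γ with
  | nil => exact absurd hb₀ (Set.disjoint_left.mp hAB ha₀)
  | @cons _ v _ hadj γ' =>
    rw [Walk.cons_isPath_iff] at hγp
    rw [Walk.length_cons] at hγl
    have hvA : v ∉ A := by
      intro hv
      have h1 : S.dist v b₀ ≤ γ'.length := SimpleGraph.dist_le γ'
      have h2 := hmin v hv b₀ hb₀
      omega
    refine ⟨a₀, v, ha₀, hvA, hadj, fun a ha b hb w => ?_⟩
    by_contra hw
    -- paths inside `A` from `a₀` to `a` and inside `B` from `b` to `b₀`
    obtain ⟨pA, hpA, -⟩ := (hS.connected a₀ a).exists_path_of_dist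
    obtain ⟨pB, hpB, -⟩ := (hS.connected b b₀).exists_path_of_dist
    have hpA' : s(a₀, v) ∉ pA.edges := fun h =>
      hvA (hA a₀ ha₀ a ha pA hpA v (Walk.snd_mem_support_of_mem_edges pA h))
    have hpB' : s(a₀, v) ∉ pB.edges := fun h =>
      Set.disjoint_left.mp hAB ha₀ (hB b hb b₀ hb₀ pB hpB a₀ (Walk.fst_mem_support_of_mem_edges pB h))
    have hγ'' : s(a₀, v) ∉ γ'.reverse.edges := fun h => by
      rw [Walk.edges_reverse, List.mem_reverse] at h
      exact hγp.2 (Walk.fst_mem_support_of_mem_edges γ' h)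
    -- the circuit through the bridge `a₀ ~ v`
    have hmem := hbridge hadj (pA.append (w.append (pB.append γ'.reverse)))
    simp only [Walk.edges_append, List.mem_append] at hmem
    rcases hmem with h | h | h | h
    · exact hpA' h
    · exact hw h
    · exact hpB' h
    · exact hγ'' h

namespace SemiGraph

open CategoryTheory

variable {T : SemiGraph.{u}}

/-! ### Fixed loci of automorphisms of a semi-graph tree -/

/-- An automorphism fixing a branch fixes the vertex it abuts to. [cite: MochizukiSemiAnbd2006, Lem. 1.8(ii) p.20] -/
theorem vertexMap_eq_of_branchMap_eq (φ : Aut T) {β : T.Branch} (hβ : φ.hom.branchMap β = β) {z : T.Vertex}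
    (hz : T.abuts β = some z) : φ.hom.vertexMap z = z := by
  have h := φ.hom.abuts_branchMap β z hz
  rw [hβ, hz] at h
  exact (Option.some.inj h).symm

/-- An automorphism fixing a branch fixes its edge. [cite: MochizukiSemiAnbd2006, Lem. 1.8(ii) p.20] -/
theorem edgeMap_eq_of_branchMap_eq (φ : Aut T) {β : T.Branch} (hβ : φ.hom.branchMap β = β) :
    φ.hom.edgeMap (T.edgeOf β) = T.edgeOf β := by
  rw [← φ.hom.edgeOf_branchMap, hβ]

/-- **Two automorphisms of a tree without a common fixed vertex are separated by an edge-point** lying on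
every walk of the barycentric subdivision from a vertex fixed by the first to a vertex fixed by the second
(automorphisms without inversions, all branches abutting, each with some fixed vertex).
[cite: MochizukiSemiAnbd2006, Lem. 1.8(ii)(b) p.20] -/
theorem exists_edge_forall_walk_mem_support (hT : T.IsTree) (φ ψ : Aut T)
    (hbr : ∀ β : T.Branch, ∃ z : T.Vertex, T.abuts β = some z)
    (hφ : ∀ e : T.Edge, φ.hom.edgeMap e = e → ∀ β : T.Branch, T.edgeOf β = e → φ.hom.branchMap β = β)
    (hψ : ∀ e : T.Edge, ψ.hom.edgeMap e = e → ∀ β : T.Branch, T.edgeOf β = e → ψ.hom.branchMap β = β)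
    {a₀ b₀ : T.Vertex} (ha₀ : φ.hom.vertexMap a₀ = a₀) (hb₀ : ψ.hom.vertexMap b₀ = b₀)
    (hno : ∀ z : T.Vertex, φ.hom.vertexMap z = z → ψ.hom.vertexMap z ≠ z) :
    ∃ e₀ : T.Edge, ∀ a b : T.Vertex, φ.hom.vertexMap a = a → ψ.hom.vertexMap b = b →
      ∀ w : T.subdivision.Walk (Sum.inl a) (Sum.inl b), (Sum.inr (Sum.inl e₀) : T.Node) ∈ w.support := by
  classical
  -- the fixed loci as node sets: convex, disjoint, non-empty
  set A : Set T.Node := {x | nodeMap φ x = x} with hAdef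
  set B : Set T.Node := {x | nodeMap ψ x = x} with hBdef
  have hA : ∀ x ∈ A, ∀ y ∈ A, ∀ q : T.subdivision.Walk x y, q.IsPath → ∀ z ∈ q.support, z ∈ A :=
    fun x hx y hy q hq => nodeMap_eq_self_of_isPath hT.isTree.isAcyclic φ hx hy q hq
  have hB : ∀ x ∈ B, ∀ y ∈ B, ∀ q : T.subdivision.Walk x y, q.IsPath → ∀ z ∈ q.support, z ∈ B :=
    fun x hx y hy q hq => nodeMap_eq_self_of_isPath hT.isTree.isAcyclic ψ hx hy q hq
  -- a common fixed edge or branch would give a common fixed vertex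
  have hfixE : ∀ (χ : Aut T), (∀ e : T.Edge, χ.hom.edgeMap e = e → ∀ β : T.Branch, T.edgeOf β = e →
      χ.hom.branchMap β = β) → ∀ e : T.Edge, χ.hom.edgeMap e = e →
      ∀ β : T.Branch, T.edgeOf β = e → ∀ z, T.abuts β = some z → χ.hom.vertexMap z = z :=
    fun χ hχ e he β hβe z hz => vertexMap_eq_of_branchMap_eq χ (hχ e he β hβe) hz
  have hAB : Disjoint A B := by
    rw [Set.disjoint_left]
    rintro x hx hx'
    change nodeMap φ x = x at hx
    change nodeMap ψ x = x at hx'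
    rcases x with z | e | β
    · simp only [nodeMap_inl, Sum.inl.injEq] at hx hx'
      exact hno z hx hx'
    · simp only [nodeMap_inr_inl, Sum.inr.injEq, Sum.inl.injEq] at hx hx'
      obtain ⟨β, -, -, hβe, -, -⟩ := T.two_branches e
      obtain ⟨z, hz⟩ := hbr β
      exact hno z (hfixE φ hφ e hx β hβe z hz) (hfixE ψ hψ e hx' β hβe z hz)
    · simp only [nodeMap_inr_inr, Sum.inr.injEq] at hx hx'
      obtain ⟨z, hz⟩ := hbr β
      exact hno z (vertexMap_eq_of_branchMap_eq φ hx hz) (vertexMap_eq_of_branchMap_eq ψ hx' hz)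
  have hmemA : ∀ a : T.Vertex, φ.hom.vertexMap a = a → (Sum.inl a : T.Node) ∈ A := fun a ha => by
    change nodeMap φ (Sum.inl a) = Sum.inl a
    rw [nodeMap_inl, ha]
  have hmemB : ∀ b : T.Vertex, ψ.hom.vertexMap b = b → (Sum.inl b : T.Node) ∈ B := fun b hb => by
    change nodeMap ψ (Sum.inl b) = Sum.inl b
    rw [nodeMap_inl, hb]
  obtain ⟨u, v, huA, hvA, huv, hsep⟩ := hT.isTree.exists_adj_forall_walk_mem_edges hA hB hAB
    ⟨_, hmemA a₀ ha₀⟩ ⟨_, hmemB b₀ hb₀⟩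
  change nodeMap φ u = u at huA
  rcases u with z | e | β
  · -- `u = z` a vertex, `v = β` a branch at `z` not fixed by `φ`: the edge-point of `β` separates
    obtain ⟨β, hβz, rfl⟩ := (T.subdivision_adj_inl_iff z v).mp huv
    refine ⟨T.edgeOf β, fun a b ha hb w => ?_⟩
    have hq := hsep _ (hmemA a ha) _ (hmemB b hb) w.bypass
    have hβmem : (Sum.inr (Sum.inr β) : T.Node) ∈ w.bypass.support :=
      Walk.snd_mem_support_of_mem_edges _ hq
    obtain ⟨x, y, hx, hy, hxy, hxβ, hβy⟩ := exists_adj_adj_of_mem_support w.bypass w.bypass_isPath hβmem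
      (by simp) (by simp)
    -- the two path-neighbours of `β` are among `z` and the edge-point of `β`; they differ, so one is the edge-point
    have hnb : ∀ n : T.Node, T.subdivision.Adj (Sum.inr (Sum.inr β)) n →
        n = Sum.inr (Sum.inl (T.edgeOf β)) ∨ n = Sum.inl z := by
      intro n hn
      rcases (T.subdivision_adj_branch_iff β n).mp hn with h | ⟨z', hz', h⟩
      · exact Or.inl h
      · rw [hβz] at hz'
        rw [← Option.some.inj hz'] at h
        exact Or.inr h
    rcases hnb x hxβ.symm with hx' | hx'
    · rw [hx'] at hx
      exact w.support_bypass_subset_support hx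
    · rcases hnb y hβy with hy' | hy'
      · rw [hy'] at hy
        exact w.support_bypass_subset_support hy
      · exact absurd (hx'.trans hy'.symm) hxy
  · -- `u = e` an edge-point fixed by `φ`: it separates
    refine ⟨e, fun a b ha hb w => ?_⟩
    exact Walk.fst_mem_support_of_mem_edges _ (hsep _ (hmemA a ha) _ (hmemB b hb) w)
  · -- `u = β` a branch fixed by `φ`: its neighbours (its edge, its vertex) are fixed too — impossible
    exfalso
    simp only [nodeMap_inr_inr, Sum.inr.injEq] at huA
    apply hvA
    rcases (T.subdivision_adj_branch_iff β v).mp huv with h | ⟨z, hz, h⟩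
    · rw [h]
      change nodeMap φ _ = _
      rw [nodeMap_inr_inl, edgeMap_eq_of_branchMap_eq φ huA]
    · rw [h]
      exact hmemA z (vertexMap_eq_of_branchMap_eq φ huA hz)

/-! ### Morphisms: walks of the subdivision -/

/-- **A morphism of semi-graphs maps walks of the barycentric subdivision to walks** (with the image support).
[cite: MochizukiSemiAnbd2006, §1 pp.11-12] -/
theorem exists_walk_nodeMap {G G' : SemiGraph.{u}} (π : G ⟶ G') {x y : G.Node} (p : G.subdivision.Walk x y) :
    ∃ q : G'.subdivision.Walk (Hom.nodeMap π x) (Hom.nodeMap π y),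
      q.support = p.support.map (Hom.nodeMap π) := by
  let f : G.subdivision →g G'.subdivision :=
    { toFun := Hom.nodeMap π, map_rel' := fun h => G.subdivision_adj_map π h }
  exact ⟨p.map f, by rw [Walk.support_map]; rfl⟩

/-- A node mapping to an edge-point is an edge-point, over that edge. [cite: MochizukiSemiAnbd2006, §1 p.11] -/
theorem Hom.nodeMap_eq_edge_iff {G G' : SemiGraph.{u}} (π : G ⟶ G') (x : G.Node) (e' : G'.Edge) :
    Hom.nodeMap π x = Sum.inr (Sum.inl e') ↔ ∃ e : G.Edge, x = Sum.inr (Sum.inl e) ∧ π.edgeMap e = e' := by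
  rcases x with z | e | β
  · simp [Hom.nodeMap]
  · simp [Hom.nodeMap]
  · simp [Hom.nodeMap]

end SemiGraph

end Literature.AnabelianGeometry.SemiGraphs
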